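import Summits.Ventures.HSemireg.WeilFramePolarisationVolume

/-!
# Venture HSemireg — THEOREM R_f on the real carriers in EVERY lower degree and in the middle degree, with no input by value:
# the contraction spans `S_m` of `Σ (q_m/m!) ĥ^m + ĉ₊ + ĉ₋` on `ΛH¹(A)` for a Weil-type abelian `2n`-fold

HONEST FRAMING. Part of the Lean index of the computation cell `pub-hsemireg` (seat w3-mod4-1 gen 8, W3 SPECIAL FIBRES,
MOD4-OFFSPLIT §13). The tree's real carriers (`complexBetti A.X 1`, `hodgeZeroOne`, the bridge's degree-`m` contraction span
`WedgeBridge.S ℂ H^{0,1} m x = ρ(⋀^m (H^{0,1} × Ann H^{0,1})) · x`) and the Literature's Weil-type layer ONLY: no semiregularity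
map is constructed; nothing here says that HC / HC_CM / HC_AV holds; nothing here is a claim about any explicit variety; no
Literature fact is declared; NO definition is introduced. The reading «`S_m` = the `HT^m`-contraction span» is the cell's dictionary
(STRUCTURE.md D9; kernel in degree `2` as `contractionRank`, `ContractionRankWeil.lean`).

WHAT IS PROVED. FILE 10 gave the door's degree-`2` number (`contractionRank`) with no input by value. The same transport gives
THEOREM R_f's other clauses on the real carrier `ΛH¹(A)`: for `A` of dimension `2n`, `φ ≫ φ = -(d • 𝟙 A)`, `d ≥ 1`, `P = V₊`,
`Q = V₋`, balanced multiplicity `p_{i√d} = n`, a `K`-symmetric `(1,1)`-class `h` with `ĥ^{2n} ≠ 0`, NON-ZERO Weil classes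
`c± ∈ E±`, and `x = Σ_{m ≤ 2n} (q_m/m!) ĥ^m + ĉ₊ + ĉ₋`:
`weilBlocks_of_sq_eq_neg` (all five block facts from ONE multiplicity), **`finrank_S_weilType_deg`** (`1 ≤ m ≤ n - 1`:
`dim S_m(x) + 2C(n,m)·r_m = 2C(2n,m) + C(2n,m)·r_m`), **`finrank_S_weilType_one`** (the one-sided column, `E₊`-part only) and
**`finrank_S_weilType_middle`** (if `(2n)!·(ĉ₊ ĉ₋) = t·ĥ^{2n}` then
`dim S_n(x) + 2r_n + dim ker(M_f(q) - t) = (r_n + 2)·C(2n,n)` — the pin READ OFF THE CLASSES). Everything PROVED, 0 sorry.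
References: [vanGeemen1994HodgeAV] 4.9, Lemma 5.2; [BuchweitzFlenner2008HH] Prop. 6.4.4; [BourbakiAlgebre1a3] Ch. III §11 no. 9.
-/

noncomputable section

open CliffordAlgebra (contractLeft)
open ExteriorAlgebra (ι)
open Module CategoryTheory
open Literature.AlgebraicGeometry.Motives Literature.AlgebraicGeometry.HodgeTheory
open Literature.AlgebraicTopology.SingularHomology

namespace Summit.Ventures.HSemireg.WeilFrame

open Summit.Ventures.HSemireg.WedgeBridge Summit.Ventures.HSemireg.Wedge.Hankel

variable {A : AbelianVariety ℂ}

/-- **all block facts from one multiplicity:** for `A` of dimension `2n`, `φ ≫ φ = -(d • 𝟙 A)`, `d ≥ 1`, `P = V₊`, `Q = V₋` and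
`p_{i√d} = dim (P ∩ H^{1,0}) = n`: `dim H¹ = 4n`, `P`, `Q` disjoint of dimension `2n`, `dim H^{0,1} = 2n`,
`dim (H^{0,1} ∩ P) = dim (H^{0,1} ∩ Q) = n`. [cite: vanGeemen1994HodgeAV, 4.9] -/
theorem weilBlocks_of_sq_eq_neg (hA : IsSmoothProjective A.dim A.X) {n d : ℕ} (hdim : A.dim = n + n) (hd : 0 < d)
    {φ : A ⟶ A} (hφ : φ ≫ φ = -(d • 𝟙 A)) {P Q : Submodule ℂ (complexBetti A.X 1)}
    (hP : P = Module.End.eigenspace (complexBetti.map φ.hom.hom.hom 1).hom (Complex.I * (Real.sqrt d : ℂ)))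
    (hQ : Q = Module.End.eigenspace (complexBetti.map φ.hom.hom.hom 1).hom (-(Complex.I * (Real.sqrt d : ℂ))))
    (hp : finrank ℂ ↥(P ⊓ hodgeOneZero hA) = n) :
    finrank ℂ (complexBetti A.X 1) = (n + n) + (n + n) ∧ Disjoint P Q ∧ finrank ℂ ↥(hodgeZeroOne hA) = n + n ∧
      finrank ℂ ↥(hodgeZeroOne hA ⊓ Q) = n ∧ finrank ℂ ↥(hodgeZeroOne hA ⊓ P) = n ∧
      finrank ℂ ↥P = n + n ∧ finrank ℂ ↥Q = n + n := by
  haveI : Module.Finite ℂ (complexBetti A.X 1) := abelianVarietyCohomologyExteriorH1_holds.finite_one A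
  obtain ⟨hc, hμ⟩ := conj_I_mul_sqrt hd
  have hV : finrank ℂ (complexBetti A.X 1) = (n + n) + (n + n) := by
    rw [Literature.AlgebraicGeometry.Motives.AbelianVariety.finrank_complexBetti_one, hdim]; ring
  have hL : finrank ℂ ↥(hodgeZeroOne hA) = n + n := by rw [AbelianVariety.finrank_hodgeZeroOne_eq_dim A hA, hdim]
  have hq : finrank ℂ ↥(P ⊓ hodgeZeroOne hA) = n := by
    subst hP
    have h := finrank_eigenspace_eq_add hA φ.hom.hom.hom (Complex.I * (Real.sqrt d : ℂ))
    rw [hp] at h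
    have h2 := two_mul_finrank_eigenspace_eq hd hφ
    rw [Literature.AlgebraicGeometry.Motives.AbelianVariety.finrank_complexBetti_one, hdim] at h2
    have h3 := Nat.eq_of_mul_eq_mul_left (by norm_num : 0 < 2) h2
    exact (Nat.add_left_cancel (h3.symm.trans h)).symm
  rw [← hc] at hQ
  obtain ⟨hPQ, hP2, hQ2, hLP, hLQ⟩ := weilBlocks_of_multiplicities hA φ.hom.hom.hom hμ hP hQ hp hq
  exact ⟨hV, hPQ, hL, hLQ, hLP, hP2, hQ2⟩

/-- **THEOREM R_f, lower side degrees, on the real carrier `ΛH¹(A)` with no input by value** (`1 ≤ m`, `m + 1 ≤ n`):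
`dim S_m(Σ (q_k/k!) ĥ^k + ĉ₊ + ĉ₋) + (C(n,m) + C(n,m))·r_m(q) = 2C(2n,m) + C(2n,m)·r_m(q)`, `S_m` the bridge's degree-`m` contraction
span over `L = H^{0,1}(A)`. [cite: BuchweitzFlenner2008HH, Prop. 6.4.4] [cite: vanGeemen1994HodgeAV, 4.9 and Lemma 5.2] -/
theorem finrank_S_weilType_deg (hA : IsSmoothProjective A.dim A.X) {n d : ℕ} (hdim : A.dim = n + n) (hd : 0 < d)
    {φ : A ⟶ A} (hφ : φ ≫ φ = -(d • 𝟙 A)) {P Q : Submodule ℂ (complexBetti A.X 1)}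
    (hP : P = Module.End.eigenspace (complexBetti.map φ.hom.hom.hom 1).hom (Complex.I * (Real.sqrt d : ℂ)))
    (hQ : Q = Module.End.eigenspace (complexBetti.map φ.hom.hom.hom 1).hom (-(Complex.I * (Real.sqrt d : ℂ))))
    (hp : finrank ℂ ↥(P ⊓ hodgeOneZero hA) = n) {h : complexBetti A.X 2}
    (hh : complexBetti.map φ.hom.hom.hom 2 h = (d : ℂ) • h) (h11 : IsOfHodgeType A.dim A.X 2 1 1 h)
    (hvol : ((⋀[ℂ]^2 (complexBetti A.X 1)).subtype ((abelianVarietyCohomologyExteriorH1_holds.equiv A 2).symm h)) ^ (n + n) ≠ 0)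
    {cP cQ : complexBetti A.X (2 * n)} (hcP : cP ∈ weilClassesPlus A φ n d) (hcP0 : cP ≠ 0)
    (hcQ : cQ ∈ weilClassesMinus A φ n d) (hcQ0 : cQ ≠ 0) (q : ℕ → ℂ) {m : ℕ} (hm1 : 1 ≤ m) (hmn : m + 1 ≤ n) :
    finrank ℂ ↥(S ℂ (hodgeZeroOne hA) m
        ((∑ m ∈ Finset.range (n + n + 1), (q m * ((m.factorial : ℕ) : ℂ)⁻¹) •
            ((⋀[ℂ]^2 (complexBetti A.X 1)).subtype ((abelianVarietyCohomologyExteriorH1_holds.equiv A 2).symm h)) ^ m) +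
          (⋀[ℂ]^(2 * n) (complexBetti A.X 1)).subtype ((abelianVarietyCohomologyExteriorH1_holds.equiv A (2 * n)).symm cP) +
          (⋀[ℂ]^(2 * n) (complexBetti A.X 1)).subtype ((abelianVarietyCohomologyExteriorH1_holds.equiv A (2 * n)).symm cQ))) +
        (n.choose m + n.choose m) * (hankel1 ℂ (n + n) m q).rank =
      (n + n).choose m + (n + n).choose m + (n + n).choose m * (hankel1 ℂ (n + n) m q).rank := by
  haveI : Module.Finite ℂ (complexBetti A.X 1) := abelianVarietyCohomologyExteriorH1_holds.finite_one A
  obtain ⟨hV, hPQ, hL, hLQ, hLP, hP2, hQ2⟩ := weilBlocks_of_sq_eq_neg hA hdim hd hφ hP hQ hp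
  exact finrank_S_weilDatum_deg hV hPQ hL hLQ hLP hP2 hQ2 (exteriorOf_mem_span_weilGen hA hd hφ hP hQ hh h11)
    (hnd_of_polarisation_pow_ne_zero hA hdim hd hφ hP hQ hh h11 hvol)
    (exteriorOf_mem_topLine_of_mem_weilClassesPlus hdim hd hφ hP hcP) (exteriorOf_ne_zero hcP0)
    (exteriorOf_mem_topLine_of_mem_weilClassesMinus hdim hd hφ hQ hcQ) (exteriorOf_ne_zero hcQ0) q hm1 hmn

/-- **THEOREM R_f, one-sided column (only the `E₊`-part present), on the real carrier with no input by value** (`m + 1 ≤ n`):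
`dim S_m(Σ (q_k/k!) ĥ^k + ĉ₊) + C(n,m)·r_m(q) = C(2n,m) + C(2n,m)·r_m(q)` (an auxiliary non-zero class of the line `E₋` exists by
the tree's `finrank_weilClassesMinus_eq_one`; the `E₋`-only column is the same statement for `-φ`, which exchanges the two
eigenvalues). [cite: BuchweitzFlenner2008HH, Prop. 6.4.4] [cite: vanGeemen1994HodgeAV, 4.9] -/
theorem finrank_S_weilType_one (hA : IsSmoothProjective A.dim A.X) {n d : ℕ} (hdim : A.dim = n + n) (hd : 0 < d)
    {φ : A ⟶ A} (hφ : φ ≫ φ = -(d • 𝟙 A)) {P Q : Submodule ℂ (complexBetti A.X 1)}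
    (hP : P = Module.End.eigenspace (complexBetti.map φ.hom.hom.hom 1).hom (Complex.I * (Real.sqrt d : ℂ)))
    (hQ : Q = Module.End.eigenspace (complexBetti.map φ.hom.hom.hom 1).hom (-(Complex.I * (Real.sqrt d : ℂ))))
    (hp : finrank ℂ ↥(P ⊓ hodgeOneZero hA) = n) {h : complexBetti A.X 2}
    (hh : complexBetti.map φ.hom.hom.hom 2 h = (d : ℂ) • h) (h11 : IsOfHodgeType A.dim A.X 2 1 1 h)
    (hvol : ((⋀[ℂ]^2 (complexBetti A.X 1)).subtype ((abelianVarietyCohomologyExteriorH1_holds.equiv A 2).symm h)) ^ (n + n) ≠ 0)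
    {cP : complexBetti A.X (2 * n)} (hcP : cP ∈ weilClassesPlus A φ n d) (hcP0 : cP ≠ 0) (q : ℕ → ℂ) {m : ℕ}
    (hmn : m + 1 ≤ n) :
    finrank ℂ ↥(S ℂ (hodgeZeroOne hA) m
        ((∑ m ∈ Finset.range (n + n + 1), (q m * ((m.factorial : ℕ) : ℂ)⁻¹) •
            ((⋀[ℂ]^2 (complexBetti A.X 1)).subtype ((abelianVarietyCohomologyExteriorH1_holds.equiv A 2).symm h)) ^ m) +
          (⋀[ℂ]^(2 * n) (complexBetti A.X 1)).subtype ((abelianVarietyCohomologyExteriorH1_holds.equiv A (2 * n)).symm cP))) +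
        n.choose m * (hankel1 ℂ (n + n) m q).rank =
      (n + n).choose m + (n + n).choose m * (hankel1 ℂ (n + n) m q).rank := by
  haveI : Module.Finite ℂ (complexBetti A.X 1) := abelianVarietyCohomologyExteriorH1_holds.finite_one A
  obtain ⟨hV, hPQ, hL, hLQ, hLP, hP2, hQ2⟩ := weilBlocks_of_sq_eq_neg hA hdim hd hφ hP hQ hp
  -- an auxiliary non-zero class on the line `E₋`
  have hb₁ : finrank ℂ (complexBetti A.X 1) = 2 * (2 * n) := by rw [hV]; ring
  have hne : weilClassesMinus A φ n d ≠ ⊥ := by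
    intro hbot
    have h1 := finrank_weilClassesMinus_eq_one (abelianVarietyCohomologyExteriorH1_holds.hasExteriorCohomologyH1 A) hb₁ hd hφ
    rw [hbot, finrank_bot] at h1
    exact zero_ne_one h1
  obtain ⟨cQ, hcQ, hcQ0⟩ := Submodule.exists_mem_ne_zero_of_ne_bot hne
  exact finrank_S_weilDatum_one hV hPQ hL hLQ hLP hP2 hQ2 (exteriorOf_mem_span_weilGen hA hd hφ hP hQ hh h11)
    (hnd_of_polarisation_pow_ne_zero hA hdim hd hφ hP hQ hh h11 hvol)
    (exteriorOf_mem_topLine_of_mem_weilClassesPlus hdim hd hφ hP hcP) (exteriorOf_ne_zero hcP0)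
    (exteriorOf_mem_topLine_of_mem_weilClassesMinus hdim hd hφ hQ hcQ) (exteriorOf_ne_zero hcQ0) q hmn

/-- **THEOREM R_f, middle degree, on the real carrier with the pin read off the classes** (`n ≥ 1`): if
`(2n)!·(ĉ₊ · ĉ₋) = t·ĥ^{2n}` in `ΛH¹(A)` («`t = ∫ c₊ c₋ / D = (-1)ⁿτ`»), then
`dim S_n(x) + 2r_n(q) + dim ker(M_f(q) - t) = (r_n(q) + 2)·C(2n,n)`. [cite: BuchweitzFlenner2008HH, Prop. 6.4.4] -/
theorem finrank_S_weilType_middle (hA : IsSmoothProjective A.dim A.X) {n d : ℕ} (hdim : A.dim = n + n) (hd : 0 < d)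
    {φ : A ⟶ A} (hφ : φ ≫ φ = -(d • 𝟙 A)) {P Q : Submodule ℂ (complexBetti A.X 1)}
    (hP : P = Module.End.eigenspace (complexBetti.map φ.hom.hom.hom 1).hom (Complex.I * (Real.sqrt d : ℂ)))
    (hQ : Q = Module.End.eigenspace (complexBetti.map φ.hom.hom.hom 1).hom (-(Complex.I * (Real.sqrt d : ℂ))))
    (hp : finrank ℂ ↥(P ⊓ hodgeOneZero hA) = n) {h : complexBetti A.X 2}
    (hh : complexBetti.map φ.hom.hom.hom 2 h = (d : ℂ) • h) (h11 : IsOfHodgeType A.dim A.X 2 1 1 h)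
    (hvol : ((⋀[ℂ]^2 (complexBetti A.X 1)).subtype ((abelianVarietyCohomologyExteriorH1_holds.equiv A 2).symm h)) ^ (n + n) ≠ 0)
    {cP cQ : complexBetti A.X (2 * n)} (hcP : cP ∈ weilClassesPlus A φ n d) (hcP0 : cP ≠ 0)
    (hcQ : cQ ∈ weilClassesMinus A φ n d) (hcQ0 : cQ ≠ 0) (hn : 1 ≤ n) (q : ℕ → ℂ) {t : ℂ}
    (ht : (((n + n).factorial : ℕ) : ℂ) •
        ((⋀[ℂ]^(2 * n) (complexBetti A.X 1)).subtype ((abelianVarietyCohomologyExteriorH1_holds.equiv A (2 * n)).symm cP) *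
          (⋀[ℂ]^(2 * n) (complexBetti A.X 1)).subtype ((abelianVarietyCohomologyExteriorH1_holds.equiv A (2 * n)).symm cQ)) =
      t • ((⋀[ℂ]^2 (complexBetti A.X 1)).subtype ((abelianVarietyCohomologyExteriorH1_holds.equiv A 2).symm h)) ^ (n + n)) :
    finrank ℂ ↥(S ℂ (hodgeZeroOne hA) n
        ((∑ m ∈ Finset.range (n + n + 1), (q m * ((m.factorial : ℕ) : ℂ)⁻¹) •
            ((⋀[ℂ]^2 (complexBetti A.X 1)).subtype ((abelianVarietyCohomologyExteriorH1_holds.equiv A 2).symm h)) ^ m) +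
          (⋀[ℂ]^(2 * n) (complexBetti A.X 1)).subtype ((abelianVarietyCohomologyExteriorH1_holds.equiv A (2 * n)).symm cP) +
          (⋀[ℂ]^(2 * n) (complexBetti A.X 1)).subtype ((abelianVarietyCohomologyExteriorH1_holds.equiv A (2 * n)).symm cQ))) +
        2 * (hankel1 ℂ (n + n) n q).rank +
        finrank ℂ ↥(LinearMap.ker (Matrix.toLin' (Mod4.middleM n q) - t • LinearMap.id)) =
      ((hankel1 ℂ (n + n) n q).rank + 2) * (n + n).choose n := by
  haveI : Module.Finite ℂ (complexBetti A.X 1) := abelianVarietyCohomologyExteriorH1_holds.finite_one A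
  obtain ⟨hV, hPQ, hL, hLQ, hLP, hP2, hQ2⟩ := weilBlocks_of_sq_eq_neg hA hdim hd hφ hP hQ hp
  exact finrank_S_weilDatum_middle hV hPQ hL hLQ hLP hP2 hQ2 (exteriorOf_mem_span_weilGen hA hd hφ hP hQ hh h11)
    (hnd_of_polarisation_pow_ne_zero hA hdim hd hφ hP hQ hh h11 hvol)
    (exteriorOf_mem_topLine_of_mem_weilClassesPlus hdim hd hφ hP hcP) (exteriorOf_ne_zero hcP0)
    (exteriorOf_mem_topLine_of_mem_weilClassesMinus hdim hd hφ hQ hcQ) (exteriorOf_ne_zero hcQ0) hn q ht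

end Summit.Ventures.HSemireg.WeilFrame

end
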